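import Summits.QuantumFields.BalabanUV.T4Continuum.Support.NE2FromNE3BavgBridge
import Summits.QuantumFields.BalabanUV.T4Continuum.Support.B13ReadingsLineProducts

/-!
# B13ReadingsAvgTowerDirect — row NE5, located junction J-avg-reg (GAPS § G-ne5p1-Javg-reg), file 2 of 2: WHAT THE CORRECTED STRAIGHT-LINE
# STRUCTURE OF AN AVERAGING TOWER GIVES, WITH EXPLICIT CONSTANTS, for the tower letters row NE2's bridge
# `NE2FromNE3BavgBridge.localRate_regClass_of_bavg_consistent` DISPLAYS — (ℓ1) size ∕ Lipschitz of the coarse connection, (ℓ3) block-average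
# consistency `hbavg` — from the fine level's (3.35)-shape letters, the STRUCTURE «coarse transporter = correction factor × ordered product of the
# `L` fine transporters along the straight line» and the correction letter `‖C − 1‖ ≤ κ∕(lev L k)²`; the second-order letters (ℓ2) `hlipD`,
# (ℓ4) `hbavgD` stay DISPLAYED

Cell `pub-balaban`, unit `b2b-balaban-t4-ne5-p1` (row NE5 OWNER, gen 39; owner item «g39-a», `HOME/CLAIMS.log` NOTE + INTENT l.22995, GAPS
§ G-ne5p1-Javg-reg (gen 39)).  Summits-side NEW WORK under the LEAN PLACEMENT RULE: [folklore] lattice bookkeeping on the ABSTRACT transporter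
towers of rows NE2 ∕ B5 (`RegularBackgroundTower`, `NE2FromNE3BavgBridge` currency: `idx`, `lev`, `cpt`, `off`, `tstep`, `bavg`) + file 1's
product estimates BY NAME; 0 `def`, no `Prop`-valued fact minted, nothing printed asserted, no citation tag.  HONEST FRAMING: rung (B)+1 of the
FINITE-VOLUME T⁴ programme — NOT infinite volume, NOT a mass gap, NOT the Clay problem, NOT a proof of NE5 (NOT PRINTED; GAPS G-t4-U3-1), NOT
a proof of NE2, NOT a statement about Bałaban's block average `BlockAveraging.blockAvg` (the STRUCTURE hypothesis below is DISPLAYED and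
inhabited here by nobody; its instance for `towerOf P ι (j ↦ (blockAvg ℰ)^j V)` — `avgFun ℰ U c = corr ℰ U c * axialAvg U c`, [Balaban1987RG1]
(0.4) KIND — and the correction letter `κ` — [Balaban1985Averaging] Props 1–2 KIND — belong to whoever takes J-avg-reg).  HONEST DEPENDENCY
(cell, verbatim): continuum YM on T⁴ ⇐ BetaPertH ∧ nine spine estimates (0/9 proved); BetaPertH ⇐ (D1) ∧ (D4) ∧ CAP+tail; G-an2-4 gates asym,
D1 and NE2/3/4.

WHY.  On the W1 chain of record after R58 (SKELETON D48′) the binder `hloc : ∀ V ∈ dom, LocalRate (bgReadings L M (regClass L M (liftR L M (RgV V)))) C θ`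
of `B13ReadingsRecordRate` ∕ W-21c `SubstrateO1ReadingsShiftRate` is produced by row NE2's bridge from FOUR letters on each background's tower:
(ℓ1) levelwise `RegularTransporters` (size `α`, Lipschitz `β`), (ℓ2) `hlipD`, (ℓ3) `hbavg` (coarse connection vs the LINEAR block mean of the
fine one, `γ∕lev L k`), (ℓ4) `hbavgD`.  For row NE5 these towers are AVERAGING towers of regular real fine fields, and no tree module states
(ℓ1)–(ℓ4) for them (J-avg-reg).  This file proves the FIRST-ORDER part of that junction at the abstract level (ONE STEP, `n = L`; file 1 is
generic in `n` for the direct multi-level representation), so that the instance-holder owes only the structure identity and `κ`: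
* §3 from `RegularTransporters L M R α β` (only its level-`(k+1)` fields are used), the structure at one coarse index
  `R k μ i = C * lprod (fun t => R (k+1) μ (s + tstep μ t, i.2)) L` and `‖C − 1‖ ≤ κ∕(lev L k)²`: SIZE `‖connTower R k μ i‖ ≤ α + (κe^α + α²)∕lev L k`
  (`norm_connTower_le_of_corrLine`, `α ≤ 1`), LIPSCHITZ `‖connTower R k μ (i + e_ν) − connTower R k μ i‖ ≤ e^α(2κ + (1+κ)β)∕lev L k`
  (`connTower_lipschitz_of_corrLine`, two lines `L` fine `ν`-steps apart; ONE-STEP form — iterated level by level it COMPOUNDS), and — the point —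
  CONSISTENCY `‖bavg (connTower R (k+1) μ) i − connTower R k μ i‖ ≤ (κe^α + α² + (2d+1)β)∕lev L k` (`bavg_consistent_of_corrLine`, line starting
  at the block member `cpt i.1 + off j₀`; the line mean is within `(2d+1)·L·lip` of the block average by NE2's `norm_sub_tstep_le` ∕
  `norm_sub_of_block_le` ∕ `norm_bavg_sub_le` BY NAME);
* §4 ENDs in row NE2's binder shapes: `hbavg_of_corrLines` = the `hbavg` letter of `localRate_regClass_of_bavg_consistent` TOKEN FOR TOKEN at
  `γ := κe^α + α² + (2d+1)β`; `localRate_connTower_of_corrLines` = `LocalRate (bgReadings L M {connTower R}) (γ + 2dβ) L⁻¹` for the connection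
  member with NO second-order letter (NE2's `localRate_of_bavg_consistent` BY NAME); `localRate_regClass_of_corrLines` = ROOT B's binder on the
  full class `regClass R` with (ℓ2) `hlipD` and (ℓ4) `hbavgD` DISPLAYED (they do NOT follow from first-order letters: second differences of
  line means gain no factor `1∕lev L k`; [Balaban1985BackgroundPropagators] (3.36) ∕ [Balaban1985Averaging] Props 5–10 KIND).
WHAT IS NOT HERE.  No instance: the structure for Bałaban's averaging of record, the multi-level (direct) structure, the correction bound `κ`
(non-abelian Stokes from the fine plaquettes + `BlockAveragingEMLAnalyticMean.norm_eml_sub_one_le`), the window-uniformity in `V`, and the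
second-order letters.  VALUE UNCHANGED: NE5 NOT PRINTED ∕ NOT PROVED; 0∕12 leaves on Bałaban's concrete objects; spine 0∕9.
0 sorry; axioms ⊆ {propext, Classical.choice, Quot.sound}.
-/

noncomputable section

open scoped BigOperators Matrix Matrix.Norms.L2Operator

namespace Summit.QuantumFields.BalabanUV.T4Continuum.B13ReadingsAvgTowerDirect

open Summit.QuantumFields.BalabanUV.T4Continuum.B13ReadingsLineProducts

/-! ## §3 In the tower currency of rows NE2 ∕ B5: the letters (ℓ1) size ∕ Lipschitz and (ℓ3) block-average consistency AT LEVEL `k`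
from the level-`(k+1)` letters, the DISPLAYED structure «coarse transporter = correction × straight product of the `L` fine ones» and
the correction letter `‖C − 1‖ ≤ κ ∕ (lev L k)²` -/

section Tower

open Literature.MathematicalPhysics.QuantumFieldTheory.Balaban1983to89.B5Prop11Plancherel (fine Tor unitVec)
open Literature.MathematicalPhysics.QuantumFieldTheory.Balaban1983to89.B5Block118 (tstep tstep_zero tstep_succ)
open Literature.MathematicalPhysics.QuantumFieldTheory.Balaban1983to89.B5G183RateTorus (cpt)
open Literature.MathematicalPhysics.QuantumFieldTheory.Balaban1983to89.B5G183RateTorusW (off)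
open Literature.MathematicalPhysics.QuantumFieldTheory.Balaban1983to89.B5G183RateUnitTower (lev lev_neZero)
open Summit.QuantumFields.BalabanUV.T4Continuum.BalabanAveragedTowerUnit (idx one_le_lev' cast_lev' lev_succ')
open Summit.QuantumFields.BalabanUV.T4Continuum.BlockPairingGeometry (tau)
open Summit.QuantumFields.BalabanUV.T4Continuum.CovariantLinePlanting (bavg)
open Summit.QuantumFields.BalabanUV.T4Continuum.RegularBackgroundTower (RegularTransporters connTower connTower_eq connTower_tau_sub
  connTower_lipschitz)
open Summit.QuantumFields.BalabanUV.T4Continuum.NE2FromNE3BavgBridge (norm_sub_tstep_le norm_sub_of_block_le norm_bavg_sub_le)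

variable {d : ℕ} (L : ℕ) [NeZero L] (M : Fin d → ℕ) [hM : ∀ μ, NeZero (M μ)]
variable {o : Type*} [Fintype o] [DecidableEq o]
variable {R : (k : ℕ) → Fin d → (idx L M k → Matrix o o ℂ)} {α β : ℝ}

/-! Convention (as in `NE2FromNE3BavgBridge`): level-`(k+1)` sites are written in `Tor (fine (L * lev L k) M)` (`lev L (k+1) = L·lev L k`
by `rfl`), where `cpt`, `off`, `bavg (lev L k) L M` live. -/

omit hM in
/-- [folklore] the plain (unscaled) Lipschitz bound of the level-`(k+1)` transporters: `‖R(x + e_ν) − R(x)‖ ≤ β∕ℓ′∕ℓ′`, `ℓ′ = L·lev L k`. -/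
theorem norm_R_tau_sub_le (h : RegularTransporters L M R α β) (k : ℕ) (μ ν : Fin d) (x : Tor (fine (L * lev L k) M) × Fin d) :
    ‖R (k + 1) μ (tau (fine (L * lev L k) M) ν x) - R (k + 1) μ x‖ ≤ β / ((L * lev L k : ℕ) : ℝ) / ((L * lev L k : ℕ) : ℝ) := by
  have hℓ1 : 1 ≤ L * lev L k := one_le_lev' L (k + 1)
  have hℓ : (0 : ℝ) < ((L * lev L k : ℕ) : ℝ) := by exact_mod_cast hℓ1
  have h1 := connTower_lipschitz h (k + 1) μ ν x
  rw [connTower_tau_sub, norm_smul, Complex.norm_natCast] at h1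
  rw [le_div_iff₀ hℓ, mul_comm]; exact h1

omit hM in
/-- [folklore] along a straight line of `L` fine `μ`-bonds shifted by `L` fine `ν`-steps: factorwise distance `≤ L·β∕ℓ′∕ℓ′`. -/
theorem norm_R_line_shift_sub_le (h : RegularTransporters L M R α β) (k : ℕ) (μ ν : Fin d) (s : Tor (fine (L * lev L k) M)) (c : Fin d)
    (t : ℕ) :
    ‖R (k + 1) μ (s + tstep (fine (L * lev L k) M) μ t, c)
        - R (k + 1) μ (s + tstep (fine (L * lev L k) M) ν L + tstep (fine (L * lev L k) M) μ t, c)‖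
      ≤ L * (β / ((L * lev L k : ℕ) : ℝ) / ((L * lev L k : ℕ) : ℝ)) := by
  rw [add_right_comm s, norm_sub_rev]
  exact norm_sub_tstep_le (R (k + 1) μ) (fun ν' x => norm_R_tau_sub_le L M h k μ ν' x) _ c ν L

omit [NeZero L] hM in
/-- [folklore] the scaled size letter of the `L` fine factors along a straight line, in the form §2 consumes. -/
theorem scaled_size_line (h : RegularTransporters L M R α β) (k : ℕ) (μ : Fin d) (s : Tor (fine (L * lev L k) M)) (c : Fin d) :
    ∀ t < L, ‖((L * lev L k : ℕ) : ℂ) • (R (k + 1) μ (s + tstep (fine (L * lev L k) M) μ t, c) - 1)‖ ≤ α :=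
  fun t _ => h.size (k + 1) μ (s + tstep (fine (L * lev L k) M) μ t, c)

omit hM in
/-- [folklore] `0 ≤ κ` from the correction letter. -/
theorem kappa_nonneg_of_corr {C : Matrix o o ℂ} {κ : ℝ} {k : ℕ} (hC : ‖C - 1‖ ≤ κ / ((lev L k : ℕ) : ℝ) ^ 2) : 0 ≤ κ := by
  have hℓ : (0 : ℝ) < ((lev L k : ℕ) : ℝ) ^ 2 := by have := one_le_lev' L k; positivity
  have := (norm_nonneg _).trans hC
  rwa [le_div_iff₀ hℓ, zero_mul] at this

omit hM in
/-- [folklore] arithmetic: `ℓ·(κ∕ℓ²)·e^{α∕ℓ} ≤ κ·e^α∕ℓ` for `ℓ ≥ 1`, `α, κ ≥ 0`. -/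
theorem corr_term_le {α κ : ℝ} (hα : 0 ≤ α) (hκ : 0 ≤ κ) (k : ℕ) :
    ((lev L k : ℕ) : ℝ) * (κ / ((lev L k : ℕ) : ℝ) ^ 2) * Real.exp (α / (lev L k : ℕ)) ≤ κ * Real.exp α / (lev L k : ℕ) := by
  have hℓ : (1 : ℝ) ≤ (lev L k : ℕ) := by exact_mod_cast one_le_lev' L k
  have hℓ0 : (0 : ℝ) < (lev L k : ℕ) := by linarith
  have hexp : Real.exp (α / (lev L k : ℕ)) ≤ Real.exp α := Real.exp_le_exp.2 (div_le_self hα hℓ)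
  calc ((lev L k : ℕ) : ℝ) * (κ / ((lev L k : ℕ) : ℝ) ^ 2) * Real.exp (α / (lev L k : ℕ))
      = κ / (lev L k : ℕ) * Real.exp (α / (lev L k : ℕ)) := by field_simp
    _ ≤ κ / (lev L k : ℕ) * Real.exp α := mul_le_mul_of_nonneg_left hexp (by positivity)
    _ = κ * Real.exp α / (lev L k : ℕ) := by ring

omit hM in
/-- [folklore] **(ℓ1) SIZE AT LEVEL `k`** from the level-`(k+1)` size letter, the structure «`R k μ i = C · Π_{t<L} R (k+1) μ (s + t e_μ, i.2)`»
and `‖C − 1‖ ≤ κ∕(lev L k)²` (with `α ≤ 1`): `‖connTower R k μ i‖ ≤ α + (κ·e^α + α²)∕lev L k`. -/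
theorem norm_connTower_le_of_corrLine (h : RegularTransporters L M R α β) (hα1 : α ≤ 1) {κ : ℝ} {k : ℕ} {μ : Fin d}
    {i : idx L M k} {C : Matrix o o ℂ} {s : Tor (fine (L * lev L k) M)}
    (hstruct : R k μ i = C * lprod (fun t => R (k + 1) μ (s + tstep (fine (L * lev L k) M) μ t, i.2)) L)
    (hC : ‖C - 1‖ ≤ κ / ((lev L k : ℕ) : ℝ) ^ 2) :
    ‖connTower L M R k μ i‖ ≤ α + (κ * Real.exp α + α ^ 2) / (lev L k : ℕ) := by
  have hL : 0 < L := Nat.pos_of_ne_zero (NeZero.ne L)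
  have hℓ1 := one_le_lev' L k
  have hℓ : (1 : ℝ) ≤ (lev L k : ℕ) := by exact_mod_cast hℓ1
  have hκ : 0 ≤ κ := kappa_nonneg_of_corr L hC
  have hmain := norm_scaled_corrLine_le (A := Matrix o o ℂ) hℓ1 hL (scaled_size_line L M h k μ s i.2) (hα1.trans hℓ) hC
  rw [connTower_eq, hstruct]
  refine hmain.trans (add_le_add le_rfl ?_)
  rw [add_div]
  exact add_le_add (corr_term_le L h.nonneg.1 hκ k) le_rfl

omit hM in
/-- [folklore] arithmetic of the Lipschitz bound: `ℓ·e^{α∕ℓ}·(2κ∕ℓ² + (1 + κ∕ℓ²)·L·(L·β∕ℓ′∕ℓ′)) ≤ e^α(2κ + (1+κ)β)∕ℓ`, `ℓ′ = Lℓ`. -/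
theorem lip_term_le {α β κ : ℝ} (hα : 0 ≤ α) (hβ : 0 ≤ β) (hκ : 0 ≤ κ) (hL : 0 < L) (k : ℕ) :
    ((lev L k : ℕ) : ℝ) * Real.exp (α / (lev L k : ℕ))
        * (2 * κ / ((lev L k : ℕ) : ℝ) ^ 2
          + (1 + κ / ((lev L k : ℕ) : ℝ) ^ 2) * L * (L * (β / ((L * lev L k : ℕ) : ℝ) / ((L * lev L k : ℕ) : ℝ))))
      ≤ Real.exp α * (2 * κ + (1 + κ) * β) / (lev L k : ℕ) := by
  have hℓ : (1 : ℝ) ≤ (lev L k : ℕ) := by exact_mod_cast one_le_lev' L k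
  have hℓ0 : (0 : ℝ) < (lev L k : ℕ) := by linarith
  have hLr : (0 : ℝ) < L := by exact_mod_cast hL
  have hexp : Real.exp (α / (lev L k : ℕ)) ≤ Real.exp α := Real.exp_le_exp.2 (div_le_self hα hℓ)
  have hLℓ : (L : ℝ) * (L * (β / ((L * lev L k : ℕ) : ℝ) / ((L * lev L k : ℕ) : ℝ))) = β / ((lev L k : ℕ) : ℝ) ^ 2 := by
    rw [Nat.cast_mul]; field_simp
  have hk1 : 1 + κ / ((lev L k : ℕ) : ℝ) ^ 2 ≤ 1 + κ := by
    refine add_le_add le_rfl (div_le_self hκ ?_)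
    nlinarith
  calc ((lev L k : ℕ) : ℝ) * Real.exp (α / (lev L k : ℕ))
        * (2 * κ / ((lev L k : ℕ) : ℝ) ^ 2
          + (1 + κ / ((lev L k : ℕ) : ℝ) ^ 2) * L * (L * (β / ((L * lev L k : ℕ) : ℝ) / ((L * lev L k : ℕ) : ℝ))))
      = Real.exp (α / (lev L k : ℕ)) * (2 * κ + (1 + κ / ((lev L k : ℕ) : ℝ) ^ 2) * β) / (lev L k : ℕ) := by
        rw [mul_assoc (1 + κ / _), hLℓ]; field_simp
    _ ≤ Real.exp α * (2 * κ + (1 + κ) * β) / (lev L k : ℕ) := by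
        gcongr

omit hM in
/-- [folklore] **(ℓ1) LIPSCHITZ AT LEVEL `k`** from the level-`(k+1)` letters and the structure at `i` and at `i + e_ν` (the two straight lines
`L` fine `ν`-steps apart), corrections within `κ∕(lev L k)²` of `1` (with `α ≤ 1`):
`‖connTower R k μ (i + e_ν) − connTower R k μ i‖ ≤ e^α·(2κ + (1 + κ)β)∕lev L k`.  ONE-STEP form: iterated level by level this bound
COMPOUNDS; a k-uniform Lipschitz letter wants §2 applied ONCE with `n = L^{K+1−k}` finest factors (the direct representation). -/
theorem connTower_lipschitz_of_corrLine (h : RegularTransporters L M R α β) {κ : ℝ} {k : ℕ} {μ ν : Fin d}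
    {i : idx L M k} {C C' : Matrix o o ℂ} {s : Tor (fine (L * lev L k) M)}
    (hstruct : R k μ i = C * lprod (fun t => R (k + 1) μ (s + tstep (fine (L * lev L k) M) μ t, i.2)) L)
    (hstruct' : R k μ (tau (fine (lev L k) M) ν i)
      = C' * lprod (fun t => R (k + 1) μ (s + tstep (fine (L * lev L k) M) ν L + tstep (fine (L * lev L k) M) μ t, i.2)) L)
    (hC : ‖C - 1‖ ≤ κ / ((lev L k : ℕ) : ℝ) ^ 2) (hC' : ‖C' - 1‖ ≤ κ / ((lev L k : ℕ) : ℝ) ^ 2) :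
    ‖connTower L M R k μ (tau (fine (lev L k) M) ν i) - connTower L M R k μ i‖
      ≤ Real.exp α * (2 * κ + (1 + κ) * β) / (lev L k : ℕ) := by
  have hL : 0 < L := Nat.pos_of_ne_zero (NeZero.ne L)
  have hℓ1 := one_le_lev' L k
  have hκ : 0 ≤ κ := kappa_nonneg_of_corr L hC
  have hCC : ‖C' - C‖ ≤ 2 * κ / ((lev L k : ℕ) : ℝ) ^ 2 := by
    calc ‖C' - C‖ = ‖(C' - 1) - (C - 1)‖ := by rw [sub_sub_sub_cancel_right]
      _ ≤ ‖C' - 1‖ + ‖C - 1‖ := norm_sub_le _ _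
      _ ≤ κ / ((lev L k : ℕ) : ℝ) ^ 2 + κ / ((lev L k : ℕ) : ℝ) ^ 2 := add_le_add hC' hC
      _ = 2 * κ / ((lev L k : ℕ) : ℝ) ^ 2 := by ring
  have hmain := norm_scaled_corrLine_sub_corrLine_le (A := Matrix o o ℂ) hℓ1 hL (scaled_size_line L M h k μ s i.2)
    (scaled_size_line L M h k μ (s + tstep (fine (L * lev L k) M) ν L) i.2) (fun t _ => norm_R_line_shift_sub_le L M h k μ ν s i.2 t)
    hC hCC
  rw [connTower_eq, connTower_eq, ← smul_sub, sub_sub_sub_cancel_right, hstruct, hstruct']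
  exact hmain.trans (lip_term_le L h.nonneg.1 h.nonneg.2 hκ hL k)

omit hM in
/-- [folklore] **THE LINE MEAN VS THE BLOCK AVERAGE** for a lattice-Lipschitz level-`(k+1)` family `a` (`lip`-Lipschitz per fine step) and a
straight line of `L` sites in direction `μ` starting at the block member `cpt i.1 + off j₀`: `‖L⁻¹ Σ_{t<L} a(line t) − bavg a i‖ ≤ (2d+1)·L·lip`. -/
theorem norm_lineAvg_sub_bavg_le {k : ℕ} (a : Tor (fine (L * lev L k) M) × Fin d → Matrix o o ℂ) {lip : ℝ} (hlip0 : 0 ≤ lip)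
    (hlip : ∀ ν x, ‖a (tau (fine (L * lev L k) M) ν x) - a x‖ ≤ lip) (μ : Fin d) (i : idx L M k) (j₀ : Fin d → Fin L) :
    ‖((L : ℕ) : ℂ)⁻¹ • ∑ t ∈ Finset.range L,
          a (cpt (lev L k) L M i.1 + off (lev L k) L M j₀ + tstep (fine (L * lev L k) M) μ t, i.2)
        - bavg (lev L k) L M a i‖ ≤ (2 * d + 1) * L * lip := by
  have hL : 0 < L := Nat.pos_of_ne_zero (NeZero.ne L)
  have hLr : (0 : ℝ) < L := by exact_mod_cast hL
  have hLc : ((L : ℕ) : ℂ) ≠ 0 := by exact_mod_cast hL.ne'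
  have hblock : ‖bavg (lev L k) L M a i - a (cpt (lev L k) L M i.1 + off (lev L k) L M j₀, i.2)‖ ≤ 2 * (d * L * lip) :=
    norm_bavg_sub_le a i _ fun j => norm_sub_of_block_le a hlip0 hlip i.1 i.2 j j₀
  have hterm : ∀ t ∈ Finset.range L,
      ‖a (cpt (lev L k) L M i.1 + off (lev L k) L M j₀ + tstep (fine (L * lev L k) M) μ t, i.2) - bavg (lev L k) L M a i‖
        ≤ (2 * d + 1) * L * lip := by
    intro t ht
    have ht' : (t : ℝ) ≤ L := by exact_mod_cast (Finset.mem_range.1 ht).le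
    calc ‖a (cpt (lev L k) L M i.1 + off (lev L k) L M j₀ + tstep (fine (L * lev L k) M) μ t, i.2) - bavg (lev L k) L M a i‖
        ≤ ‖a (cpt (lev L k) L M i.1 + off (lev L k) L M j₀ + tstep (fine (L * lev L k) M) μ t, i.2)
              - a (cpt (lev L k) L M i.1 + off (lev L k) L M j₀, i.2)‖
            + ‖a (cpt (lev L k) L M i.1 + off (lev L k) L M j₀, i.2) - bavg (lev L k) L M a i‖ := norm_sub_le_norm_sub_add_norm_sub _ _ _
      _ ≤ t * lip + 2 * (d * L * lip) :=
          add_le_add (norm_sub_tstep_le a hlip _ i.2 μ t) (by rw [norm_sub_rev]; exact hblock)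
      _ ≤ L * lip + 2 * (d * L * lip) := by gcongr
      _ = (2 * d + 1) * L * lip := by ring
  have e : ((L : ℕ) : ℂ)⁻¹ • ∑ t ∈ Finset.range L,
          a (cpt (lev L k) L M i.1 + off (lev L k) L M j₀ + tstep (fine (L * lev L k) M) μ t, i.2) - bavg (lev L k) L M a i
      = ((L : ℕ) : ℂ)⁻¹ • ∑ t ∈ Finset.range L,
          (a (cpt (lev L k) L M i.1 + off (lev L k) L M j₀ + tstep (fine (L * lev L k) M) μ t, i.2) - bavg (lev L k) L M a i) := by
    rw [Finset.sum_sub_distrib, Finset.sum_const, Finset.card_range, smul_sub, ← Nat.cast_smul_eq_nsmul ℂ, smul_smul,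
      inv_mul_cancel₀ hLc, one_smul]
  rw [e, norm_smul, norm_inv, Complex.norm_natCast]
  calc (L : ℝ)⁻¹ * ‖∑ t ∈ Finset.range L,
          (a (cpt (lev L k) L M i.1 + off (lev L k) L M j₀ + tstep (fine (L * lev L k) M) μ t, i.2) - bavg (lev L k) L M a i)‖
      ≤ (L : ℝ)⁻¹ * ∑ t ∈ Finset.range L,
          ‖a (cpt (lev L k) L M i.1 + off (lev L k) L M j₀ + tstep (fine (L * lev L k) M) μ t, i.2) - bavg (lev L k) L M a i‖ :=
        mul_le_mul_of_nonneg_left (norm_sum_le _ _) (by positivity)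
    _ ≤ (L : ℝ)⁻¹ * ∑ _t ∈ Finset.range L, (2 * d + 1) * L * lip := mul_le_mul_of_nonneg_left (Finset.sum_le_sum hterm) (by positivity)
    _ = (2 * d + 1) * L * lip := by rw [Finset.sum_const, Finset.card_range, nsmul_eq_mul, ← mul_assoc, inv_mul_cancel₀ hLr.ne', one_mul]

omit hM in
/-- [folklore] **(ℓ3) BLOCK-AVERAGE CONSISTENCY AT LEVEL `k`** — the `hbavg` letter of `NE2FromNE3BavgBridge.localRate_regClass_of_bavg_consistent`
for the connection tower — from the level-`(k+1)` letters, the structure with the straight line of the `L` fine `μ`-bonds STARTING IN THE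
BLOCK of `i` (`s = cpt i.1 + off j₀`) and `‖C − 1‖ ≤ κ∕(lev L k)²` (with `α ≤ 1`):
`‖bavg (connTower R (k+1) μ) i − connTower R k μ i‖ ≤ (κ·e^α + α² + (2d+1)·β)∕lev L k`. -/
theorem bavg_consistent_of_corrLine (h : RegularTransporters L M R α β) (hα1 : α ≤ 1) {κ : ℝ} {k : ℕ} {μ : Fin d}
    {i : idx L M k} {C : Matrix o o ℂ} {j₀ : Fin d → Fin L}
    (hstruct : R k μ i = C * lprod (fun t => R (k + 1) μ
      (cpt (lev L k) L M i.1 + off (lev L k) L M j₀ + tstep (fine (L * lev L k) M) μ t, i.2)) L)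
    (hC : ‖C - 1‖ ≤ κ / ((lev L k : ℕ) : ℝ) ^ 2) :
    ‖bavg (lev L k) L M (connTower L M R (k + 1) μ) i - connTower L M R k μ i‖
      ≤ (κ * Real.exp α + α ^ 2 + (2 * d + 1) * β) / (lev L k : ℕ) := by
  have hL : 0 < L := Nat.pos_of_ne_zero (NeZero.ne L)
  have hℓ1 := one_le_lev' L k
  have hℓ : (1 : ℝ) ≤ (lev L k : ℕ) := by exact_mod_cast hℓ1
  have hℓ0 : (0 : ℝ) < (lev L k : ℕ) := by linarith
  have hβ0 : 0 ≤ β := h.nonneg.2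
  have hκ : 0 ≤ κ := kappa_nonneg_of_corr L hC
  -- (1) the corrected line product vs the line mean
  have h1 := norm_scaled_corrLine_sub_lineMean_le (A := Matrix o o ℂ) hℓ1 hL
    (scaled_size_line L M h k μ (cpt (lev L k) L M i.1 + off (lev L k) L M j₀) i.2) (hα1.trans hℓ) hC
  have h1' : ‖((lev L k : ℕ) : ℂ) • (C * lprod (fun t => R (k + 1) μ
        (cpt (lev L k) L M i.1 + off (lev L k) L M j₀ + tstep (fine (L * lev L k) M) μ t, i.2)) L - 1)
        - lineMean (L * lev L k) L (fun t => R (k + 1) μ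
          (cpt (lev L k) L M i.1 + off (lev L k) L M j₀ + tstep (fine (L * lev L k) M) μ t, i.2))‖
      ≤ (κ * Real.exp α + α ^ 2) / (lev L k : ℕ) := by
    refine h1.trans ?_
    rw [add_div]
    exact add_le_add (corr_term_le L h.nonneg.1 hκ k) le_rfl
  -- (2) the line mean IS `L⁻¹ Σ_t connTower (k+1) μ (line t)` and is within `(2d+1)β/lev L k` of the block average
  have hlm : lineMean (L * lev L k) L (fun t => R (k + 1) μ
          (cpt (lev L k) L M i.1 + off (lev L k) L M j₀ + tstep (fine (L * lev L k) M) μ t, i.2))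
      = ((L : ℕ) : ℂ)⁻¹ • ∑ t ∈ Finset.range L, connTower L M R (k + 1) μ
          (cpt (lev L k) L M i.1 + off (lev L k) L M j₀ + tstep (fine (L * lev L k) M) μ t, i.2) := rfl
  have h2 := norm_lineAvg_sub_bavg_le L M (k := k) (connTower L M R (k + 1) μ) (div_nonneg hβ0 (Nat.cast_nonneg _))
    (fun ν x => connTower_lipschitz h (k + 1) μ ν x) μ i j₀
  have h2' : (2 * (d : ℝ) + 1) * L * (β / ((lev L (k + 1) : ℕ) : ℝ)) = (2 * d + 1) * β / (lev L k : ℕ) := by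
    rw [lev_succ', Nat.cast_mul]; field_simp
  have h2'' : ‖lineMean (L * lev L k) L (fun t => R (k + 1) μ
          (cpt (lev L k) L M i.1 + off (lev L k) L M j₀ + tstep (fine (L * lev L k) M) μ t, i.2))
        - bavg (lev L k) L M (connTower L M R (k + 1) μ) i‖ ≤ (2 * d + 1) * β / (lev L k : ℕ) := by
    rw [hlm, ← h2']; exact h2
  -- (3) assemble
  have hfin := (norm_sub_le_norm_sub_add_norm_sub _ _ _).trans (add_le_add h1' h2'')
  rw [connTower_eq R k μ i, hstruct, norm_sub_rev]
  refine hfin.trans_eq ?_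
  ring

end Tower

/-! ## §4 ENDs in row NE2's currency: the `hbavg` letter of `NE2FromNE3BavgBridge` for the connection tower from the DISPLAYED structure of an
averaging tower, and the resulting `LocalRate` faces (connection member: no second-order letter; full `regClass`: (ℓ2)(ℓ4) displayed) -/

section Ends

open Literature.MathematicalPhysics.QuantumFieldTheory.Balaban1983to89.B5Prop11Plancherel (fine Tor)
open Literature.MathematicalPhysics.QuantumFieldTheory.Balaban1983to89.B5Block118 (tstep)
open Literature.MathematicalPhysics.QuantumFieldTheory.Balaban1983to89.B5G183RateTorus (cpt)
open Literature.MathematicalPhysics.QuantumFieldTheory.Balaban1983to89.B5G183RateTorusW (off)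
open Literature.MathematicalPhysics.QuantumFieldTheory.Balaban1983to89.B5G183RateUnitTower (lev lev_neZero)
open Literature.MathematicalPhysics.QuantumFieldTheory.Balaban1983to89.T4EtaRateMin (LocalRate)
open Summit.QuantumFields.BalabanUV.T4Continuum.BalabanAveragedTowerUnit (idx one_le_lev')
open Summit.QuantumFields.BalabanUV.T4Continuum.BlockPairingGeometry (tau)
open Summit.QuantumFields.BalabanUV.T4Continuum.CovariantLinePlanting (bavg)
open Summit.QuantumFields.BalabanUV.T4Continuum.RegularBackgroundTower (RegularTransporters connTower dconnTower regClass connTower_lipschitz)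
open Summit.QuantumFields.BalabanUV.T4Continuum.NE2FromNE3 (bgReadings)
open Summit.QuantumFields.BalabanUV.T4Continuum.NE2FromNE3BavgBridge (localRate_of_bavg_consistent localRate_regClass_of_bavg_consistent)

variable {d : ℕ} (L : ℕ) [NeZero L] (M : Fin d → ℕ) [hM : ∀ μ, NeZero (M μ)]
variable {o : Type*} [Fintype o] [DecidableEq o]
variable {R : (k : ℕ) → Fin d → (idx L M k → Matrix o o ℂ)} {α β : ℝ}

omit hM in
/-- [folklore] **THE `hbavg` LETTER OF `NE2FromNE3BavgBridge.localRate_regClass_of_bavg_consistent` FOR THE CONNECTION TOWER, PRODUCED** from: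
levelwise regularity `h` with `α ≤ 1`; the DISPLAYED STRUCTURE of an averaging tower — at every level, direction and index, the coarse
transporter is a correction factor `Cf k μ i` times the ordered product of the `L` fine transporters along the straight `μ`-line starting at the
block member `cpt i.1 + off (j₀ k μ i)` (for Bałaban's `blockAvg ℰ`: `avgFun ℰ U c = corr ℰ U c * axialAvg U c`, tree
`BlockAveraging` — the identification is the instance-holder's, NOT made here); and the correction letter `‖Cf k μ i − 1‖ ≤ κ∕(lev L k)²`.
Constant `γ = κ·e^α + α² + (2d+1)·β`, level-independent. -/
theorem hbavg_of_corrLines (h : RegularTransporters L M R α β) (hα1 : α ≤ 1) {κ : ℝ}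
    {Cf : (k : ℕ) → Fin d → idx L M k → Matrix o o ℂ} {j₀ : (k : ℕ) → Fin d → idx L M k → (Fin d → Fin L)}
    (hstruct : ∀ k μ (i : idx L M k), R k μ i = Cf k μ i * lprod (fun t => R (k + 1) μ
      (cpt (lev L k) L M i.1 + off (lev L k) L M (j₀ k μ i) + tstep (fine (L * lev L k) M) μ t, i.2)) L)
    (hC : ∀ k μ (i : idx L M k), ‖Cf k μ i - 1‖ ≤ κ / ((lev L k : ℕ) : ℝ) ^ 2) :
    ∀ k μ (y : idx L M k), ‖bavg (lev L k) L M (connTower L M R (k + 1) μ) y - connTower L M R k μ y‖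
      ≤ (κ * Real.exp α + α ^ 2 + (2 * d + 1) * β) / (lev L k : ℕ) :=
  fun k μ y => bavg_consistent_of_corrLine L M h hα1 (hstruct k μ y) (hC k μ y)

/-- [folklore] **END (connection member, NO second-order letter): `LocalRate` OF THE SINGLETON CLASS `{connTower R}`** at constant
`(κ·e^α + α² + (2d+1)·β) + 2d·β` and rate `L⁻¹` — row NE2's `localRate_of_bavg_consistent` BY NAME, its two binders discharged by
`RegularTransporters.lipschitz` and `hbavg_of_corrLines`. -/
theorem localRate_connTower_of_corrLines (h : RegularTransporters L M R α β) (hα1 : α ≤ 1) {κ : ℝ}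
    {Cf : (k : ℕ) → Fin d → idx L M k → Matrix o o ℂ} {j₀ : (k : ℕ) → Fin d → idx L M k → (Fin d → Fin L)}
    (hstruct : ∀ k μ (i : idx L M k), R k μ i = Cf k μ i * lprod (fun t => R (k + 1) μ
      (cpt (lev L k) L M i.1 + off (lev L k) L M (j₀ k μ i) + tstep (fine (L * lev L k) M) μ t, i.2)) L)
    (hC : ∀ k μ (i : idx L M k), ‖Cf k μ i - 1‖ ≤ κ / ((lev L k : ℕ) : ℝ) ^ 2) :
    LocalRate (bgReadings L M {connTower L M R}) ((κ * Real.exp α + α ^ 2 + (2 * d + 1) * β) + 2 * d * β) ((L : ℝ)⁻¹) :=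
  localRate_of_bavg_consistent L M h.nonneg.2
    (fun W hW k μ ν i => by rw [Set.mem_singleton_iff.1 hW]; exact connTower_lipschitz h k μ ν i)
    (fun W hW k μ y => by rw [Set.mem_singleton_iff.1 hW]; exact hbavg_of_corrLines L M h hα1 hstruct hC k μ y)

/-- [folklore] **END (full class `regClass R = {w, D_νw_ν}`): ROOT B's binder `LocalRate (bgReadings … (regClass …))`** from levelwise regularity, the
structure and the correction letter — which discharge (ℓ3) — and the two SECOND-ORDER letters that remain DISPLAYED: (ℓ2) `hlipD` (Lipschitz
`βD∕lev L k` of the derivative tower) and (ℓ4) `hbavgD` (block-average consistency `γD∕lev L k` of the derivative tower).  Row NE2's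
`localRate_regClass_of_bavg_consistent` BY NAME at `γ := max (κ·e^α + α² + (2d+1)·β) γD`. -/
theorem localRate_regClass_of_corrLines (h : RegularTransporters L M R α β) (hα1 : α ≤ 1) {κ βD γD : ℝ}
    {Cf : (k : ℕ) → Fin d → idx L M k → Matrix o o ℂ} {j₀ : (k : ℕ) → Fin d → idx L M k → (Fin d → Fin L)}
    (hstruct : ∀ k μ (i : idx L M k), R k μ i = Cf k μ i * lprod (fun t => R (k + 1) μ
      (cpt (lev L k) L M i.1 + off (lev L k) L M (j₀ k μ i) + tstep (fine (L * lev L k) M) μ t, i.2)) L)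
    (hC : ∀ k μ (i : idx L M k), ‖Cf k μ i - 1‖ ≤ κ / ((lev L k : ℕ) : ℝ) ^ 2) (hβD : 0 ≤ βD)
    (hlipD : ∀ k μ ν (i : idx L M k),
      ‖dconnTower L M R k μ (tau (fine (lev L k) M) ν i) - dconnTower L M R k μ i‖ ≤ βD / (lev L k : ℕ))
    (hbavgD : ∀ k μ (y : idx L M k), ‖bavg (lev L k) L M (dconnTower L M R (k + 1) μ) y - dconnTower L M R k μ y‖ ≤ γD / (lev L k : ℕ)) :
    LocalRate (bgReadings L M (regClass L M R))
      (max (κ * Real.exp α + α ^ 2 + (2 * d + 1) * β) γD + 2 * d * max β βD) ((L : ℝ)⁻¹) := by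
  refine localRate_regClass_of_bavg_consistent L M h hβD hlipD (fun k μ y => ?_) (fun k μ y => ?_)
  · exact (hbavg_of_corrLines L M h hα1 hstruct hC k μ y).trans
      (div_le_div_of_nonneg_right (le_max_left _ _) (Nat.cast_nonneg _))
  · exact (hbavgD k μ y).trans (div_le_div_of_nonneg_right (le_max_right _ _) (Nat.cast_nonneg _))

end Ends

end Summit.QuantumFields.BalabanUV.T4Continuum.B13ReadingsAvgTowerDirect

end
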